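import Literature.Analysis.FluidPDE.ESSLocalHolderBlowupFarField
import Literature.Analysis.FluidPDE.SuitableWeakExhaustion
import Literature.Analysis.FluidPDE.CKNLocalEnergyBound
import Literature.Analysis.FluidPDE.L3DataLocalEnergy
import Literature.Analysis.FluidPDE.ESSLocalHolderCovering
import HarnessLib

/-!
# ESS Thm. 1.4 (`ess_local_holder`): the blow-up limit as a local energy solution on the
# half-space `ℝ³ × ]-∞, 0[` — suitability, uniformly local energy, dissipation and decay

Analysis/FluidPDE proofs-only file (theorems only: no definitions, no named facts) in the
bottom-up discharge of `Literature.Analysis.FluidPDE.ess_local_holder` (L. Escauriaza,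
G. Seregin, V. Šverák, Russ. Math. Surveys 58:2 (2003) 211–250, Thm. 1.4), on the line through
Lemarié-Rieusset's backward uniqueness theorem for local Leray solutions
(`lemarieRieusset_backward_uniqueness_slab`, *The Navier–Stokes Problem in the 21st Century*
(2016), Thm. 15.4; see `SuitableWeakRightContinuity.lean`). The blow-up limit `(w, π)` of
`exists_blowup_limit` is a suitable weak solution on every parabolic ball `Q(a)`, `a > 0`, with
the scale-invariant sliced bound `∫_{B(a)} |w(s)|³ ≤ M` and the pressure bound `D(a) ≤ D⋆`
(`ESSLocalHolderBlowupProperties.lean`); G. Seregin, *Lecture Notes on Regularity Theory for the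
Navier–Stokes Equations* (2014), §6.6 calls such a pair a **local energy ancient solution**. This
file verifies, in the original time variable `s < 0`, the clauses of Lemarié-Rieusset's class of
local Leray solutions (the tree's `IsLocalLeraySolutionOn`, Kang–Miura–Tsai Def. 3.2) that do not
involve the initial time:

* `isSuitableWeakSolutionOn_halfspace` — `(w, π)` is a suitable weak solution on the open
  half-space `]-∞, 0[ × ℝ³` (exhaustion by the `Q(n+1)`, `IsSuitableWeakSolutionOn.of_exhaustion`);
* `locallyIntegrableOn_cube_halfspace` — `|w|³ ∈ L¹_loc` there;
* `lintegral_box_pressure_lt_top`, `lintegral_box_sq_lt_top` — `π ∈ L^{3/2}`, `w ∈ L²` on the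
  boxes `]-T, 0[ × K` (from (6.6.9), `lintegral_slab_cube_add_pressure_le`);
* `exists_ae_forall_lintegral_ball_sq_le` — **uniformly local energy**:
  `∫_{B(x₀,R)} |w(s)|² ≤ C(R, M)` for a.e. `s < 0` and every centre (Hölder on the ball and the
  global sliced `L³` bound, Seregin 2014, p. 129);
* `exists_weakGradient_uniform_dissipation` — **uniformly local dissipation**: a weak spatial
  gradient `∇w` on the half-space with `sup_{x₀} ∫∫_{]-T,0[ × B(x₀,R)} |∇w|² < ∞` (the absolute
  local energy bound of Caffarelli–Kohn–Nirenberg / Lemarié-Rieusset, proof of Thm. 14.4, the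
  tree's `localEnergyBound`, on cylinders hanging from apexes `t₁ ↑ 0`, with `C(ρ)` and `D(ρ)`
  controlled by the global bound (6.6.9));
* `tendsto_lintegral_box_sq_cocompact` — **decay at spatial infinity**,
  `∫∫_{]-T,0[ × B(x₀,R)} |w|² → 0` as `|x₀| → ∞` (Hölder and the far-field smallness
  `exists_farField_small`, ESS (3.22) / Seregin (6.6.10)).

Nothing accepted is restated or changed; no `sorry`.

## References

* L. Escauriaza, G. Seregin, V. Šverák, Russ. Math. Surveys 58:2 (2003) 211–250: §3,
  (3.13)–(3.22). [`EscauriazaSereginSverak2003`]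
* G. Seregin, *Lecture Notes on Regularity Theory for the Navier–Stokes Equations*, World
  Scientific (2014), §6.6, Prop. 6.20, (6.6.9)–(6.6.10), p. 129. [`Seregin2014`]
* P. G. Lemarié-Rieusset, *The Navier–Stokes Problem in the 21st Century* (2016), Def. 14.1,
  proof of Thm. 14.4, Thm. 15.4. [`LemarieRieusset2016`]
* K. Kang, H. Miura, T.-P. Tsai, IMRN 2021 = arXiv:1812.10509, Def. 3.2. [`KangMiuraTsai2020`]
-/

noncomputable section

open MeasureTheory Set Function Filter Topology TopologicalSpace Metric
open scoped NNReal ENNReal InnerProductSpace RealInnerProductSpace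

namespace Literature.Analysis.FluidPDE

namespace ESSBlowup

variable {w : ℝ → EuclideanSpace ℝ (Fin 3) → EuclideanSpace ℝ (Fin 3)}
  {π : ℝ → EuclideanSpace ℝ (Fin 3) → ℝ}

/-! ### The half-space `]-∞, 0[ × ℝ³` and its exhaustion by the parabolic balls `Q(n+1)` -/

/-- `Q(a) ⊆ ]-∞, 0[ × ℝ³`. [folklore] -/
theorem parabolicCylinderOpens_le_halfspace (a : ℝ) :
    (parabolicCylinderOpens a (0 : ℝ × EuclideanSpace ℝ (Fin 3))) ≤
      slab (EuclideanSpace ℝ (Fin 3)) (Iio 0) isOpen_Iio := by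
  intro z hz
  have hz' : z ∈ parabolicCylinder a (0 : ℝ × EuclideanSpace ℝ (Fin 3)) := hz
  rw [SuitableCompactness.parabolicCylinder_zero] at hz'
  exact mem_slab.2 (mem_prod.1 hz').1.2

/-- A compact subset of the half-space lies in some `Q(n+1)`. [folklore] -/
theorem exists_subset_parabolicCylinder_of_isCompact {K : Set (ℝ × EuclideanSpace ℝ (Fin 3))}
    (hK : K ⊆ (slab (EuclideanSpace ℝ (Fin 3)) (Iio 0) isOpen_Iio : Set _)) (hKc : IsCompact K) :
    ∃ n : ℕ, K ⊆ parabolicCylinder ((n : ℝ) + 1) (0 : ℝ × EuclideanSpace ℝ (Fin 3)) := by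
  obtain ⟨R, hR⟩ := hKc.isBounded.subset_closedBall (0 : ℝ × EuclideanSpace ℝ (Fin 3))
  obtain ⟨n, hn⟩ := exists_nat_ge R
  refine ⟨n, fun z hz => ?_⟩
  have hzR : ‖z‖ ≤ R := by simpa [mem_closedBall, dist_zero_right] using hR hz
  have h1 : |z.1| ≤ R := (norm_fst_le z).trans hzR
  have h2 : ‖z.2‖ ≤ R := (norm_snd_le z).trans hzR
  have ht : z.1 < 0 := mem_slab.1 (hK hz)
  rw [SuitableCompactness.parabolicCylinder_zero, mem_prod, mem_Ioo, mem_ball, dist_zero_right]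
  refine ⟨⟨?_, ht⟩, by linarith⟩
  have h3 : -R ≤ z.1 := (abs_le.1 h1).1
  have h4 : (1 : ℝ) ≤ (n : ℝ) + 1 := by linarith [n.cast_nonneg (α := ℝ)]
  nlinarith

/-- **The blow-up limit is a suitable weak solution on the half-space `]-∞, 0[ × ℝ³`** (a local
energy ancient solution in the sense of Seregin 2014, §6.6: "suitable weak solution on each
parabolic ball `Q(a)`"): suitability is local and glues along the exhaustion `Q(n+1) ↑`
(`IsSuitableWeakSolutionOn.of_exhaustion`). [cite: Seregin2014, §6.6 (local energy ancient solutions)] -/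
theorem isSuitableWeakSolutionOn_halfspace
    (hw : ∀ a : ℝ, 0 < a → IsSuitableWeakSolutionInBall a (0 : ℝ × EuclideanSpace ℝ (Fin 3)) w π) :
    IsSuitableWeakSolutionOn (slab (EuclideanSpace ℝ (Fin 3)) (Iio 0) isOpen_Iio) 1 0 w π := by
  refine IsSuitableWeakSolutionOn.of_exhaustion
    (Qn := fun n : ℕ => parabolicCylinderOpens ((n : ℝ) + 1) (0 : ℝ × EuclideanSpace ℝ (Fin 3)))
    (fun n => parabolicCylinderOpens_le_halfspace _) (fun m n hmn z hz => ?_)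
    (fun K hK hKc => exists_subset_parabolicCylinder_of_isCompact hK hKc)
    (fun n => (hw _ (by positivity)).1)
  exact parabolicCylinder_zero_mono (by positivity) (by simpa using hmn) hz

/-- `|w|³` is locally integrable on the half-space (it is integrable on every `Q(a)`). [folklore] -/
theorem locallyIntegrableOn_cube_halfspace
    (hw3 : ∀ a : ℝ, 0 < a → MemLp (uncurry w) 3
      (volume.restrict (parabolicCylinder a (0 : ℝ × EuclideanSpace ℝ (Fin 3))))) :
    LocallyIntegrableOn (fun z : ℝ × EuclideanSpace ℝ (Fin 3) => ‖w z.1 z.2‖ ^ 3)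
      (slab (EuclideanSpace ℝ (Fin 3)) (Iio 0) isOpen_Iio : Set _) volume := by
  refine (locallyIntegrableOn_iff (slab (EuclideanSpace ℝ (Fin 3)) (Iio 0)
    isOpen_Iio).isOpen.isLocallyClosed).2 fun K hK hKc => ?_
  obtain ⟨n, hn⟩ := exists_subset_parabolicCylinder_of_isCompact hK hKc
  have h := (hw3 ((n : ℝ) + 1) (by positivity)).integrable_norm_rpow (by norm_num) (by norm_num)
  simp only [ENNReal.toReal_ofNat] at h
  have h' : IntegrableOn (fun z : ℝ × EuclideanSpace ℝ (Fin 3) => ‖w z.1 z.2‖ ^ 3)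
      (parabolicCylinder ((n : ℝ) + 1) (0 : ℝ × EuclideanSpace ℝ (Fin 3))) volume := by
    refine h.congr (Eventually.of_forall fun z => ?_)
    show ‖uncurry w z‖ ^ (3 : ℝ) = ‖w z.1 z.2‖ ^ 3
    rw [show (3 : ℝ) = ((3 : ℕ) : ℝ) by norm_num, Real.rpow_natCast]
    rfl
  exact h'.mono_set hn

/-! ### Boxes `]-T, 0[ × K`: the pressure and the velocity -/

/-- The pressure of the blow-up limit lies in `L^{3/2}(]-T, 0[ × K)` for every `K`
(from the global bound (6.6.9)). [cite: Seregin2014, §6.6 (6.6.9)] -/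
theorem lintegral_box_pressure_lt_top {M D : ℝ≥0}
    (hw : ∀ a : ℝ, 0 < a → IsSuitableWeakSolutionInBall a (0 : ℝ × EuclideanSpace ℝ (Fin 3)) w π)
    (hM : ∀ a : ℝ, 0 < a → ∀ᵐ s ∂(volume.restrict (Ioo (-a ^ 2) 0)),
      ∫⁻ y in ball (0 : EuclideanSpace ℝ (Fin 3)) a, ‖w s y‖ₑ ^ (3 : ℕ) ≤ M)
    (hD : ∀ a : ℝ, 0 < a → cknD a (0 : ℝ × EuclideanSpace ℝ (Fin 3)) π ≤ D) {T : ℝ} (hT : 0 < T)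
    (K : Set (EuclideanSpace ℝ (Fin 3))) :
    ∫⁻ z in Ioo (-T) 0 ×ˢ K, ‖π z.1 z.2‖ₑ ^ (3 / 2 : ℝ) < ∞ := by
  have h := lintegral_slab_cube_add_pressure_le hw hM hD hT
  refine lt_of_le_of_lt ((lintegral_mono_set (prod_mono Subset.rfl (subset_univ K))).trans
    ((lintegral_mono fun z => le_add_self).trans h)) ?_
  exact ENNReal.mul_lt_top ENNReal.ofReal_lt_top (ENNReal.add_lt_top.2 ⟨ENNReal.coe_lt_top,
    ENNReal.rpow_lt_top_of_nonneg (by norm_num) (ENNReal.mul_ne_top ENNReal.coe_ne_top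
      (ENNReal.pow_ne_top (ENNReal.rpow_ne_top_of_nonneg (by norm_num) ENNReal.coe_ne_top)))⟩)

/-- `|w|³` is integrable on the slabs `]-T, 0[ × ℝ³` (the global bound (6.6.9)). [cite: Seregin2014, §6.6 (6.6.9)] -/
theorem lintegral_slab_cube_lt_top {M D : ℝ≥0}
    (hw : ∀ a : ℝ, 0 < a → IsSuitableWeakSolutionInBall a (0 : ℝ × EuclideanSpace ℝ (Fin 3)) w π)
    (hM : ∀ a : ℝ, 0 < a → ∀ᵐ s ∂(volume.restrict (Ioo (-a ^ 2) 0)),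
      ∫⁻ y in ball (0 : EuclideanSpace ℝ (Fin 3)) a, ‖w s y‖ₑ ^ (3 : ℕ) ≤ M)
    (hD : ∀ a : ℝ, 0 < a → cknD a (0 : ℝ × EuclideanSpace ℝ (Fin 3)) π ≤ D) {T : ℝ} (hT : 0 < T) :
    ∫⁻ z in Ioo (-T) 0 ×ˢ (univ : Set (EuclideanSpace ℝ (Fin 3))), ‖w z.1 z.2‖ₑ ^ (3 : ℕ) < ∞ := by
  have h := lintegral_slab_cube_add_pressure_le hw hM hD hT
  refine lt_of_le_of_lt ((lintegral_mono fun z => le_self_add).trans h) ?_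
  exact ENNReal.mul_lt_top ENNReal.ofReal_lt_top (ENNReal.add_lt_top.2 ⟨ENNReal.coe_lt_top,
    ENNReal.rpow_lt_top_of_nonneg (by norm_num) (ENNReal.mul_ne_top ENNReal.coe_ne_top
      (ENNReal.pow_ne_top (ENNReal.rpow_ne_top_of_nonneg (by norm_num) ENNReal.coe_ne_top)))⟩)

/-- The blow-up limit lies in `L²(]-T, 0[ × K)` for every bounded `K` (`|w|² ≤ 1 + |w|³` and
the global bound (6.6.9)). [cite: Seregin2014, §6.6 (6.6.9)] -/
theorem lintegral_box_sq_lt_top {M D : ℝ≥0}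
    (hw : ∀ a : ℝ, 0 < a → IsSuitableWeakSolutionInBall a (0 : ℝ × EuclideanSpace ℝ (Fin 3)) w π)
    (hM : ∀ a : ℝ, 0 < a → ∀ᵐ s ∂(volume.restrict (Ioo (-a ^ 2) 0)),
      ∫⁻ y in ball (0 : EuclideanSpace ℝ (Fin 3)) a, ‖w s y‖ₑ ^ (3 : ℕ) ≤ M)
    (hD : ∀ a : ℝ, 0 < a → cknD a (0 : ℝ × EuclideanSpace ℝ (Fin 3)) π ≤ D) {T : ℝ} (hT : 0 < T)
    {K : Set (EuclideanSpace ℝ (Fin 3))} (hK : Bornology.IsBounded K) :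
    ∫⁻ z in Ioo (-T) 0 ×ˢ K, ‖w z.1 z.2‖ₑ ^ 2 < ∞ := by
  have hvol : volume (Ioo (-T) 0 ×ˢ K) < ∞ := by
    rw [Measure.volume_eq_prod, Measure.prod_prod]
    exact ENNReal.mul_lt_top measure_Ioo_lt_top hK.measure_lt_top
  -- `x² ≤ 1 + x³` in `ℝ≥0∞` (the tree's `ennreal_sq_le_one_add_cube`, inlined)
  have hsq : ∀ x : ℝ≥0∞, x ^ 2 ≤ 1 + x ^ 3 := fun x => by
    rcases le_or_gt x 1 with h | h
    · exact (pow_le_one₀ (zero_le) h).trans le_self_add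
    · exact (pow_le_pow_right₀ h.le (by norm_num)).trans le_add_self
  calc ∫⁻ z in Ioo (-T) 0 ×ˢ K, ‖w z.1 z.2‖ₑ ^ 2
      ≤ ∫⁻ z in Ioo (-T) 0 ×ˢ K, (1 + ‖w z.1 z.2‖ₑ ^ (3 : ℕ)) :=
        lintegral_mono fun z => hsq _
    _ = volume (Ioo (-T) 0 ×ˢ K) + ∫⁻ z in Ioo (-T) 0 ×ˢ K, ‖w z.1 z.2‖ₑ ^ (3 : ℕ) := by
        rw [lintegral_add_left measurable_const, lintegral_const, Measure.restrict_apply_univ, one_mul]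
    _ < ∞ := ENNReal.add_lt_top.2 ⟨hvol, lt_of_le_of_lt
        (lintegral_mono_set (prod_mono Subset.rfl (subset_univ K))) (lintegral_slab_cube_lt_top hw hM hD hT)⟩

/-! ### Uniformly local energy of the slices -/

/-- **Uniformly local energy of the blow-up limit** (Seregin 2014, p. 129: "by scale-invariance,
`‖u‖_{3,∞,ℝ³×]-∞,0[} < +∞`", and Hölder on the ball): for every radius `R ≥ 0` there is `C`
with `∫_{B(x₀,R)} |w(s)|² ≤ C` for a.e. `s < 0` and **every** centre `x₀`
(`lintegral_ball_enorm_sq_le_of_memLp_three` and the sliced bound `∫ |w(s)|³ ≤ M` of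
`ae_pressure_ae_eq_rieszPressure`). [cite: Seregin2014, §6.6 p. 129] -/
theorem exists_ae_forall_lintegral_ball_sq_le {M D : ℝ≥0}
    (hw : ∀ a : ℝ, 0 < a → IsSuitableWeakSolutionInBall a (0 : ℝ × EuclideanSpace ℝ (Fin 3)) w π)
    (hM : ∀ a : ℝ, 0 < a → ∀ᵐ s ∂(volume.restrict (Ioo (-a ^ 2) 0)),
      ∫⁻ y in ball (0 : EuclideanSpace ℝ (Fin 3)) a, ‖w s y‖ₑ ^ (3 : ℕ) ≤ M)
    (hD : ∀ a : ℝ, 0 < a → cknD a (0 : ℝ × EuclideanSpace ℝ (Fin 3)) π ≤ D) {R : ℝ} (hR : 0 ≤ R) :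
    ∃ C : ℝ≥0∞, C ≠ ∞ ∧ ∀ᵐ s ∂(volume.restrict (Iio (0 : ℝ))), ∀ x₀ : EuclideanSpace ℝ (Fin 3),
      ∫⁻ x in ball x₀ R, ‖w s x‖ₑ ^ 2 ≤ C := by
  refine ⟨ENNReal.ofReal R * volume (ball (0 : EuclideanSpace ℝ (Fin 3)) 1) ^ (1 / 3 : ℝ) *
      ((M : ℝ≥0∞) ^ (1 / 3 : ℝ)) ^ 2, ?_, ?_⟩
  · exact ENNReal.mul_ne_top (ENNReal.mul_ne_top ENNReal.ofReal_ne_top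
      (ENNReal.rpow_ne_top_of_nonneg (by norm_num) measure_ball_lt_top.ne))
      (ENNReal.pow_ne_top (ENNReal.rpow_ne_top_of_nonneg (by norm_num) ENNReal.coe_ne_top))
  · filter_upwards [ae_pressure_ae_eq_rieszPressure hw hM hD] with s hs x₀
    obtain ⟨h3, hle, -⟩ := hs
    refine (lintegral_ball_enorm_sq_le_of_memLp_three h3 x₀ hR).trans ?_
    gcongr
    rw [eLpNorm_three_eq_lintegral_cube_rpow]
    exact ENNReal.rpow_le_rpow hle (by norm_num)

/-! ### Decay at spatial infinity -/

/-- **Decay of the local energy of the blow-up limit at spatial infinity** (the decay clause (7)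
of Kang–Miura–Tsai's Def. 3.2, for the ancient solution): for `T > 0` and every radius `R`,
`∫∫_{]-T,0[ × B(x₀,R)} |w|² → 0` as `|x₀| → ∞` — Hölder on the box and the far-field
smallness `∫∫_{]-T,0[ × {|x|>ρ}} |w|³ → 0` (`exists_farField_small`, ESS (3.22)).
[cite: EscauriazaSereginSverak2003, §3 (3.22)] -/
theorem tendsto_lintegral_box_sq_cocompact {M D : ℝ≥0}
    (hw : ∀ a : ℝ, 0 < a → IsSuitableWeakSolutionInBall a (0 : ℝ × EuclideanSpace ℝ (Fin 3)) w π)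
    (hM : ∀ a : ℝ, 0 < a → ∀ᵐ s ∂(volume.restrict (Ioo (-a ^ 2) 0)),
      ∫⁻ y in ball (0 : EuclideanSpace ℝ (Fin 3)) a, ‖w s y‖ₑ ^ (3 : ℕ) ≤ M)
    (hD : ∀ a : ℝ, 0 < a → cknD a (0 : ℝ × EuclideanSpace ℝ (Fin 3)) π ≤ D) {T : ℝ} (hT : 0 < T)
    (R : ℝ) :
    Tendsto (fun x₀ : EuclideanSpace ℝ (Fin 3) =>
        ∫⁻ z in Ioo (-T) 0 ×ˢ ball x₀ R, ‖w z.1 z.2‖ₑ ^ 2)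
      (cocompact (EuclideanSpace ℝ (Fin 3))) (𝓝 0) := by
  -- measurability on the slab
  have hwm : AEStronglyMeasurable (uncurry w)
      (volume.restrict (Ioo (-T) 0 ×ˢ (univ : Set (EuclideanSpace ℝ (Fin 3))))) :=
    aestronglyMeasurable_slab_of_forall_cylinder
      (fun a ha => (hw a ha).1.distributional.1.aestronglyMeasurable) hT
  -- the volume of the boxes does not depend on the centre
  set V : ℝ≥0∞ := volume (Ioo (-T) (0 : ℝ)) * volume (ball (0 : EuclideanSpace ℝ (Fin 3)) R) with hV
  have hVne : V ≠ ⊤ := ENNReal.mul_ne_top measure_Ioo_lt_top.ne measure_ball_lt_top.ne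
  have hvol : ∀ x₀ : EuclideanSpace ℝ (Fin 3), volume (Ioo (-T) 0 ×ˢ ball x₀ R) = V := fun x₀ => by
    rw [Measure.volume_eq_prod, Measure.prod_prod, Measure.addHaar_ball_center volume x₀ R]
  -- Hölder on the box
  have hb : ∀ x₀ : EuclideanSpace ℝ (Fin 3), ∫⁻ z in Ioo (-T) 0 ×ˢ ball x₀ R, ‖w z.1 z.2‖ₑ ^ 2 ≤
      V ^ (1 / 3 : ℝ) * (∫⁻ z in Ioo (-T) 0 ×ˢ ball x₀ R, ‖w z.1 z.2‖ₑ ^ 3) ^ (2 / 3 : ℝ) := by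
    intro x₀
    have hm : AEStronglyMeasurable (uncurry w) (volume.restrict (Ioo (-T) 0 ×ˢ ball x₀ R)) :=
      hwm.mono_measure (Measure.restrict_mono (prod_mono Subset.rfl (subset_univ _)) le_rfl)
    have h1 := lintegral_enorm_sq_le_measure_rpow_mul (volume.restrict (Ioo (-T) 0 ×ˢ ball x₀ R)) hm
    rw [Measure.restrict_apply_univ, hvol x₀] at h1
    exact h1
  -- the cube integral on the box tends to zero
  have h3 : Tendsto (fun x₀ : EuclideanSpace ℝ (Fin 3) =>
      ∫⁻ z in Ioo (-T) 0 ×ˢ ball x₀ R, ‖w z.1 z.2‖ₑ ^ 3) (cocompact (EuclideanSpace ℝ (Fin 3))) (𝓝 0) := by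
    rw [ENNReal.tendsto_nhds_zero]
    intro ε hε
    obtain ⟨ρ, hρ, hsmall⟩ := exists_farField_small hw hM hD hT hε
    have hmem : {x₀ : EuclideanSpace ℝ (Fin 3) | ρ + R < ‖x₀‖} ∈ cocompact (EuclideanSpace ℝ (Fin 3)) := by
      have h := (isCompact_closedBall (0 : EuclideanSpace ℝ (Fin 3)) (ρ + R)).compl_mem_cocompact
      refine Filter.mem_of_superset h fun x₀ hx₀ => ?_
      simpa [mem_closedBall, dist_zero_right] using hx₀
    refine Filter.mem_of_superset hmem fun x₀ hx₀ => ?_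
    have hsub : ball x₀ R ⊆ (closedBall (0 : EuclideanSpace ℝ (Fin 3)) ρ)ᶜ := by
      intro x hx
      rw [mem_compl_iff, mem_closedBall, dist_zero_right, not_le]
      have h1 : dist x x₀ < R := hx
      have h2 : ρ + R < ‖x₀‖ := hx₀
      have h3 : ‖x₀‖ ≤ ‖x‖ + dist x x₀ := by
        calc ‖x₀‖ = dist x₀ 0 := (dist_zero_right x₀).symm
          _ ≤ dist x₀ x + dist x 0 := dist_triangle _ _ _
          _ = ‖x‖ + dist x x₀ := by rw [dist_zero_right, dist_comm, add_comm]
      linarith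
    show ∫⁻ z in Ioo (-T) 0 ×ˢ ball x₀ R, ‖w z.1 z.2‖ₑ ^ 3 ≤ ε
    calc ∫⁻ z in Ioo (-T) 0 ×ˢ ball x₀ R, ‖w z.1 z.2‖ₑ ^ 3
        ≤ ∫⁻ z in Ioo (-T) 0 ×ˢ (closedBall (0 : EuclideanSpace ℝ (Fin 3)) ρ)ᶜ, ‖w z.1 z.2‖ₑ ^ (3 : ℕ) :=
          lintegral_mono_set (prod_mono Subset.rfl hsub)
      _ ≤ ∫⁻ z in Ioo (-T) 0 ×ˢ (closedBall (0 : EuclideanSpace ℝ (Fin 3)) ρ)ᶜ,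
            (‖w z.1 z.2‖ₑ ^ (3 : ℕ) + ‖π z.1 z.2‖ₑ ^ (3 / 2 : ℝ)) := lintegral_mono fun z => le_self_add
      _ ≤ ε := hsmall.le
  have hlim : Tendsto (fun x₀ : EuclideanSpace ℝ (Fin 3) =>
      V ^ (1 / 3 : ℝ) * (∫⁻ z in Ioo (-T) 0 ×ˢ ball x₀ R, ‖w z.1 z.2‖ₑ ^ 3) ^ (2 / 3 : ℝ))
      (cocompact (EuclideanSpace ℝ (Fin 3))) (𝓝 0) := by
    have h2 : Tendsto (fun x₀ : EuclideanSpace ℝ (Fin 3) =>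
        (∫⁻ z in Ioo (-T) 0 ×ˢ ball x₀ R, ‖w z.1 z.2‖ₑ ^ 3) ^ (2 / 3 : ℝ))
        (cocompact (EuclideanSpace ℝ (Fin 3))) (𝓝 0) := by
      have := ((ENNReal.continuous_rpow_const (y := (2 / 3 : ℝ))).tendsto (0 : ℝ≥0∞)).comp h3
      rwa [ENNReal.zero_rpow_of_pos (by norm_num : (0 : ℝ) < 2 / 3)] at this
    have hne : V ^ (1 / 3 : ℝ) ≠ ⊤ := ENNReal.rpow_ne_top_of_nonneg (by norm_num) hVne
    have h4 := ENNReal.Tendsto.const_mul h2 (Or.inr hne)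
    rwa [mul_zero] at h4
  exact tendsto_of_tendsto_of_tendsto_of_le_of_le tendsto_const_nhds hlim (fun x₀ => zero_le) hb

/-! ### Uniformly local dissipation -/

/-- The closed parabolic cylinder hanging from an apex `(t₁, x₀)` with `t₁ < 0` lies in the
half-space `]-∞, 0[ × ℝ³`. [folklore] -/
theorem closure_parabolicCylinder_subset_halfspace {ρ t₁ : ℝ} (hρ : 0 < ρ) (ht₁ : t₁ < 0)
    (x₀ : EuclideanSpace ℝ (Fin 3)) :
    closure (parabolicCylinder ρ ((t₁, x₀) : ℝ × EuclideanSpace ℝ (Fin 3))) ⊆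
      (slab (EuclideanSpace ℝ (Fin 3)) (Iio 0) isOpen_Iio : Set _) := by
  rw [closure_parabolicCylinder_eq hρ]
  intro z hz
  exact mem_slab.2 (lt_of_le_of_lt (mem_prod.1 hz).1.2 ht₁)

/-- A backward parabolic cylinder hanging from `(t₁, x₀)`, `-1 ≤ t₁ < 0`, of radius `ρ` lies in
the slab `]-(ρ² + 1), 0[ × ℝ³`. [folklore] -/
theorem parabolicCylinder_subset_slab {ρ t₁ : ℝ} (ht₁ : t₁ < 0) (ht₁' : -1 ≤ t₁)
    (x₀ : EuclideanSpace ℝ (Fin 3)) :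
    parabolicCylinder ρ ((t₁, x₀) : ℝ × EuclideanSpace ℝ (Fin 3)) ⊆
      Ioo (-(ρ ^ 2 + 1)) 0 ×ˢ (univ : Set (EuclideanSpace ℝ (Fin 3))) := by
  intro z hz
  rw [mem_parabolicCylinder] at hz
  exact mem_prod.2 ⟨⟨by linarith [hz.1.1], lt_of_lt_of_le hz.1.2 ht₁.le⟩, mem_univ _⟩

/-- **Uniformly local dissipation of the blow-up limit** (the bound
`sup_{x₀} ∫∫_{]-T,0[ × B(x₀,R)} |∇w|² < ∞` of Kang–Miura–Tsai's Def. 3.2 (2), for the ancient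
solution). There is a weak spatial gradient `G` of `w` on the half-space such that for all
`T, R > 0` the dissipation on the boxes `]-T, 0[ × B(x₀, R)` is bounded independently of `x₀`.
Proof: by the absolute local energy bound (Lemarié-Rieusset 2016, proof of Thm. 14.4; the tree's
`localEnergyBound`, here with zero force) on the cylinders `Q_ρ(t₁, x₀)`, `t₁ ↑ 0`, `ρ` large,
`E(ρ/2) ≤ c (C(ρ)^{2/3} + C(ρ) + D(ρ)^{2/3} C(ρ)^{1/3})`, and `C(ρ), D(ρ) ≤ ρ⁻² ∫∫_{]-ρ²-1,0[×ℝ³}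
(|w|³ + |π|^{3/2})`, finite by (6.6.9); then let `t₁ ↑ 0` (monotone convergence).
[cite: LemarieRieusset2016, proof of Thm. 14.4 (the absolute local energy bound)] [cite: Seregin2014, §6.6 (6.6.9)] -/
theorem exists_weakGradient_uniform_dissipation {M D : ℝ≥0}
    (hw : ∀ a : ℝ, 0 < a → IsSuitableWeakSolutionInBall a (0 : ℝ × EuclideanSpace ℝ (Fin 3)) w π)
    (hM : ∀ a : ℝ, 0 < a → ∀ᵐ s ∂(volume.restrict (Ioo (-a ^ 2) 0)),
      ∫⁻ y in ball (0 : EuclideanSpace ℝ (Fin 3)) a, ‖w s y‖ₑ ^ (3 : ℕ) ≤ M)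
    (hD : ∀ a : ℝ, 0 < a → cknD a (0 : ℝ × EuclideanSpace ℝ (Fin 3)) π ≤ D) :
    ∃ G : ℝ → EuclideanSpace ℝ (Fin 3) → EuclideanSpace ℝ (Fin 3) →L[ℝ] EuclideanSpace ℝ (Fin 3),
      HasWeakSpatialGradientOn (slab (EuclideanSpace ℝ (Fin 3)) (Iio 0) isOpen_Iio) w G ∧
      ∀ T : ℝ, 0 < T → ∀ R : ℝ, 0 < R → ∃ C : ℝ≥0∞, C ≠ ∞ ∧ ∀ x₀ : EuclideanSpace ℝ (Fin 3),
        ∫⁻ z in Ioo (-T) 0 ×ˢ ball x₀ R, ENNReal.ofReal (frobeniusNormSq (G z.1 z.2)) ≤ C := by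
  have hslab := isSuitableWeakSolutionOn_halfspace hw
  obtain ⟨G, hG, -, -⟩ := hslab.localEnergy
  refine ⟨G, hG, fun T hT R hR => ?_⟩
  obtain ⟨c₁, c₂, c₃, c₄, H⟩ := localEnergyBound one_pos
  -- the radius `ρ = 2 (R + √T + 1)`: `ρ/2 ≥ R`, `(ρ/2)² ≥ T + 1`
  set ρ : ℝ := 2 * (R + Real.sqrt T + 1) with hρ
  have hρpos : 0 < ρ := by rw [hρ]; positivity
  have hρR : R ≤ 1 / 2 * ρ := by rw [hρ]; linarith [Real.sqrt_nonneg T]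
  have hρT : T + 1 ≤ (1 / 2 * ρ) ^ 2 := by
    have h1 : Real.sqrt T ^ 2 = T := Real.sq_sqrt hT.le
    have h2 : 1 / 2 * ρ = R + Real.sqrt T + 1 := by rw [hρ]; ring
    rw [h2]
    nlinarith [Real.sqrt_nonneg T, hR.le]
  -- the global bound on the slab `]-(ρ²+1), 0[ × ℝ³`
  set Γ : ℝ≥0∞ := ∫⁻ z in Ioo (-(ρ ^ 2 + 1)) 0 ×ˢ (univ : Set (EuclideanSpace ℝ (Fin 3))),
    (‖w z.1 z.2‖ₑ ^ (3 : ℕ) + ‖π z.1 z.2‖ₑ ^ (3 / 2 : ℝ)) with hΓ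
  have hΓfin : Γ ≠ ⊤ := by
    refine ne_top_of_le_ne_top ?_ (lintegral_slab_cube_add_pressure_le hw hM hD (by positivity : 0 < ρ ^ 2 + 1))
    exact ENNReal.mul_ne_top ENNReal.ofReal_ne_top (ENNReal.add_ne_top.2 ⟨ENNReal.coe_ne_top,
      ENNReal.rpow_ne_top_of_nonneg (by norm_num) (ENNReal.mul_ne_top ENNReal.coe_ne_top
        (ENNReal.pow_ne_top (ENNReal.rpow_ne_top_of_nonneg (by norm_num) ENNReal.coe_ne_top)))⟩)
  set Cb : ℝ≥0∞ := (ENNReal.ofReal ρ ^ 2)⁻¹ * Γ with hCb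
  have hCbfin : Cb ≠ ⊤ := ENNReal.mul_ne_top
    (ENNReal.inv_ne_top.2 (pow_ne_zero 2 (ENNReal.ofReal_pos.2 hρpos).ne')) hΓfin
  -- the uniform bound
  set B : ℝ≥0∞ := ENNReal.ofReal (1 / 2 * ρ) *
    (c₁ * ENNReal.ofReal ((1 / 2 : ℝ) ^ 2) * Cb ^ (2 / 3 : ℝ) +
      c₂ * ENNReal.ofReal (((1 / 2 : ℝ) ^ 2)⁻¹) * Cb +
      c₃ * ENNReal.ofReal (((1 / 2 : ℝ) ^ 2)⁻¹) * Cb ^ (2 / 3 : ℝ) * Cb ^ (1 / 3 : ℝ)) with hB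
  have hBfin : B ≠ ⊤ := by
    refine ENNReal.mul_ne_top ENNReal.ofReal_ne_top (ENNReal.add_ne_top.2 ⟨ENNReal.add_ne_top.2 ⟨?_, ?_⟩, ?_⟩)
    · exact ENNReal.mul_ne_top (ENNReal.mul_ne_top ENNReal.coe_ne_top ENNReal.ofReal_ne_top)
        (ENNReal.rpow_ne_top_of_nonneg (by norm_num) hCbfin)
    · exact ENNReal.mul_ne_top (ENNReal.mul_ne_top ENNReal.coe_ne_top ENNReal.ofReal_ne_top) hCbfin
    · exact ENNReal.mul_ne_top (ENNReal.mul_ne_top (ENNReal.mul_ne_top ENNReal.coe_ne_top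
        ENNReal.ofReal_ne_top) (ENNReal.rpow_ne_top_of_nonneg (by norm_num) hCbfin))
        (ENNReal.rpow_ne_top_of_nonneg (by norm_num) hCbfin)
  refine ⟨B, hBfin, fun x₀ => ?_⟩
  -- ## the bound on the cylinders hanging from `t₁ ∈ [-1, 0)`
  have hcyl : ∀ t₁ : ℝ, t₁ < 0 → -1 ≤ t₁ →
      ∫⁻ z in parabolicCylinder (1 / 2 * ρ) ((t₁, x₀) : ℝ × EuclideanSpace ℝ (Fin 3)),
        ENNReal.ofReal (frobeniusNormSq (G z.1 z.2)) ≤ B := by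
    intro t₁ ht₁ ht₁'
    set z₁ : ℝ × EuclideanSpace ℝ (Fin 3) := (t₁, x₀) with hz₁
    have hcl := closure_parabolicCylinder_subset_halfspace hρpos ht₁ x₀
    have hf0 : MemLp (uncurry (0 : ℝ → EuclideanSpace ℝ (Fin 3) → EuclideanSpace ℝ (Fin 3)))
        (ENNReal.ofReal (3 / 2))
        (volume.restrict (slab (EuclideanSpace ℝ (Fin 3)) (Iio 0) isOpen_Iio : Set _)) := by
      have e : uncurry (0 : ℝ → EuclideanSpace ℝ (Fin 3) → EuclideanSpace ℝ (Fin 3)) =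
          fun _ => 0 := rfl
      rw [e]
      exact MemLp.zero'
    have key := H _ (3 / 2) 0 w π G hslab (le_refl _) hf0 hG z₁ ρ (1 / 2) hρpos (by norm_num)
      (by norm_num) hcl
    -- `C(ρ) ≤ Cb`, `D(ρ) ≤ Cb`, `F = 0`
    have hsub := parabolicCylinder_subset_slab (ρ := ρ) ht₁ ht₁' x₀
    have hC : cknC ρ z₁ w ≤ Cb := by
      rw [cknC, hCb]
      exact mul_le_mul_right ((lintegral_mono_set hsub).trans (lintegral_mono fun z => le_self_add)) _
    have hDle : cknD ρ z₁ π ≤ Cb := by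
      rw [cknD, hCb]
      exact mul_le_mul_right ((lintegral_mono_set hsub).trans (lintegral_mono fun z => le_add_self)) _
    have hF : cknF (3 / 2) ρ z₁ (0 : ℝ → EuclideanSpace ℝ (Fin 3) → EuclideanSpace ℝ (Fin 3)) = 0 := by
      rw [cknF]
      simp
    have hF' : cknF (3 / 2) ρ z₁ (0 : ℝ → EuclideanSpace ℝ (Fin 3) → EuclideanSpace ℝ (Fin 3)) ^
        (1 / (3 / 2 : ℝ)) = 0 := by
      rw [hF]
      exact ENNReal.zero_rpow_of_pos (by norm_num)
    rw [hF', mul_zero, zero_mul, add_zero] at key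
    have hE : cknE (1 / 2 * ρ) z₁ G ≤
        c₁ * ENNReal.ofReal ((1 / 2 : ℝ) ^ 2) * Cb ^ (2 / 3 : ℝ) +
          c₂ * ENNReal.ofReal (((1 / 2 : ℝ) ^ 2)⁻¹) * Cb +
          c₃ * ENNReal.ofReal (((1 / 2 : ℝ) ^ 2)⁻¹) * Cb ^ (2 / 3 : ℝ) * Cb ^ (1 / 3 : ℝ) := by
      refine le_add_self.trans (key.trans ?_)
      have h23 : cknC ρ z₁ w ^ (2 / 3 : ℝ) ≤ Cb ^ (2 / 3 : ℝ) := ENNReal.rpow_le_rpow hC (by norm_num)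
      have h13 : cknC ρ z₁ w ^ (1 / 3 : ℝ) ≤ Cb ^ (1 / 3 : ℝ) := ENNReal.rpow_le_rpow hC (by norm_num)
      have hD23 : cknD ρ z₁ π ^ (2 / 3 : ℝ) ≤ Cb ^ (2 / 3 : ℝ) := ENNReal.rpow_le_rpow hDle (by norm_num)
      exact add_le_add (add_le_add (mul_le_mul_right h23 _) (mul_le_mul_right hC _))
        (mul_le_mul (mul_le_mul_right hD23 _) h13 (zero_le) (zero_le))
    -- unscale: `∫_{Q} |G|² = (ρ/2) E(ρ/2)`
    have hρ2 : 0 < 1 / 2 * ρ := by positivity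
    have hinv : ENNReal.ofReal (1 / 2 * ρ) * (ENNReal.ofReal (1 / 2 * ρ))⁻¹ = 1 :=
      ENNReal.mul_inv_cancel (ENNReal.ofReal_pos.2 hρ2).ne' ENNReal.ofReal_ne_top
    calc ∫⁻ z in parabolicCylinder (1 / 2 * ρ) z₁, ENNReal.ofReal (frobeniusNormSq (G z.1 z.2))
        = ENNReal.ofReal (1 / 2 * ρ) * cknE (1 / 2 * ρ) z₁ G := by
          rw [cknE]
          symm
          calc ENNReal.ofReal (1 / 2 * ρ) * ((ENNReal.ofReal (1 / 2 * ρ))⁻¹ *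
                ∫⁻ q in parabolicCylinder (1 / 2 * ρ) z₁, ENNReal.ofReal (frobeniusNormSq (G q.1 q.2)))
              = ENNReal.ofReal (1 / 2 * ρ) * (ENNReal.ofReal (1 / 2 * ρ))⁻¹ *
                ∫⁻ q in parabolicCylinder (1 / 2 * ρ) z₁, ENNReal.ofReal (frobeniusNormSq (G q.1 q.2)) :=
                (mul_assoc _ _ _).symm
            _ = _ := by rw [hinv, one_mul]
      _ ≤ B := by rw [hB]; exact mul_le_mul_right hE _
  -- ## the boxes `]-T, t₁[ × B(x₀, R)` with `t₁ = -1/(k+1) ↑ 0`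
  set t : ℕ → ℝ := fun k => -(1 / ((k : ℝ) + 1)) with ht
  have htneg : ∀ k, t k < 0 := fun k => by simp only [ht]; exact neg_neg_of_pos (by positivity)
  have htge : ∀ k, -1 ≤ t k := fun k => by
    simp only [ht, neg_le_neg_iff]
    rw [div_le_one (by positivity)]
    linarith [k.cast_nonneg (α := ℝ)]
  have hbox : ∀ k, Ioo (-T) (t k) ×ˢ ball x₀ R ⊆
      parabolicCylinder (1 / 2 * ρ) ((t k, x₀) : ℝ × EuclideanSpace ℝ (Fin 3)) := by
    intro k z hz
    rw [mem_parabolicCylinder]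
    obtain ⟨⟨hz1, hz2⟩, hz3⟩ := mem_prod.1 hz
    refine ⟨⟨?_, hz2⟩, lt_of_lt_of_le hz3 hρR⟩
    show t k - (1 / 2 * ρ) ^ 2 < z.1
    linarith [htneg k, hρT, hz1]
  have hk : ∀ k, ∫⁻ z in Ioo (-T) (t k) ×ˢ ball x₀ R, ENNReal.ofReal (frobeniusNormSq (G z.1 z.2)) ≤ B :=
    fun k => (lintegral_mono_set (hbox k)).trans (hcyl (t k) (htneg k) (htge k))
  -- monotone convergence in `k`
  have hmono : Monotone fun k => Ioo (-T) (t k) ×ˢ ball x₀ R := by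
    intro k l hkl
    refine prod_mono (Ioo_subset_Ioo le_rfl ?_) Subset.rfl
    simp only [ht, neg_le_neg_iff]
    exact one_div_le_one_div_of_le (by positivity) (by simpa using hkl)
  have hU : (⋃ k, Ioo (-T) (t k) ×ˢ ball x₀ R) = Ioo (-T) 0 ×ˢ ball x₀ R := by
    rw [← iUnion_prod_const]
    congr 1
    ext s
    simp only [mem_iUnion, mem_Ioo]
    constructor
    · rintro ⟨k, h1, h2⟩; exact ⟨h1, h2.trans (htneg k)⟩
    · rintro ⟨h1, h2⟩
      obtain ⟨k, hk'⟩ := exists_nat_one_div_lt (neg_pos.2 h2)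
      exact ⟨k, h1, by simp only [ht]; linarith⟩
  rw [← hU, setLIntegral_iUnion_of_directed _ hmono.directed_le]
  exact iSup_le hk

end ESSBlowup

end Literature.Analysis.FluidPDE
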